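import Summits.AtomisticToContinuum.HydrodynamicLimit.Theses.TwoClocks
import Summits.AtomisticToContinuum.HydrodynamicLimit.Theorems.OneFlightGossipEngineEquilibriumClampedCollisionalWindowLDDefs
import Summits.AtomisticToContinuum.HydrodynamicLimit.Theorems.TwoClocksClampedTransferWindowLDStubStationaryTruncation
import Summits.AtomisticToContinuum.HydrodynamicLimit.Theorems.OneFlightGossipEngineCollisionActivityTailsEndpointTails
import Summits.AtomisticToContinuum.HydrodynamicLimit.Theorems.TwoClocksTransferActivityTailsMeanTailAverage
import Summits.AtomisticToContinuum.HydrodynamicLimit.Theorems.TwoClocksTransferActivityTailsDriftEngineAvg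
import Summits.AtomisticToContinuum.HydrodynamicLimit.Theorems.TwoClocksTransferActivityTailsTaggedSumMeasurable
import Summits.AtomisticToContinuum.HydrodynamicLimit.Theorems.TwoClocksTransferActivityTailsBlockSum
import Summits.AtomisticToContinuum.HydrodynamicLimit.Theorems.TwoClocksTransferActivityTailsDriftLLNEngine
import HarnessLib

/-!
# `TransferActivityTails` (stmt-AtomisticToContinuum-16624), line `Sketch` (IdeatorFive, idea `predictor-drift-doob`):
the crux skeleton, v1.4 (lead c6)

Crux `Summit.AtomisticToContinuum.HydrodynamicLimit.Theses.TwoClocks.TransferActivityTails` (route TwoClocks, rank 7): the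
a-priori `L¹` tail bound `E_λ[(N+1)⁻¹ Σ_i a_i 𝟙{a_i > V}] ≤ ε` for the window TRANSFER activity
`a_i(s) = (σ/τ) Σ_{collisions of i in (s, s+w]} (‖v_i⁺ − v_i⁻‖ + |‖v_i⁺‖² − ‖v_i⁻‖²|/2)`, `w = τ (N+1)^{-1/3}`, under the true
evolution from local Gibbs data.

THE LINE (card `Cruxes/TransferActivityTails/Ideas/predictor-drift-doob.md`).  Cut the window into `K` consecutive blocks of
`τ₁ (N+1)^{-1/3}` (`τ ≈ K τ₁`), so that the window activity is (up to the sandwich for `τ ∉ τ₁ℕ`) the AVERAGE of the block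
activities `X_{i,j} = BlockAct σ τ₁ Φ i j s`.  Posit (CD) a one-step Foster–Lyapunov DRIFT of the predictor of the next block
given the particle's own coarse block history (`PredictorDrift`, integrated form) and (UI₁) one-block uniform integrability
(`OneBlockUI`); an ABSTRACT probability engine (`DriftLLNEngine`: truncation at `M`, Doob decomposition along `σ(X_{≤j})`,
orthogonality of bounded martingale increments, Markov/Chebyshev) gives `E[ā𝟙{ā > 4(C+1)/(1−ρ)}] ≤ M′(δ + (M² + Lm)/K) + δ′`
on every probability space, whence the crux with `V₀ = 8(C+1)/(1−ρ)` and rate `1/K = τ₁/τ`.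

Stubs (registered; sorries ONLY here):
* `stub_driftLLNEngine` — the engine (pure probability) — LANDING p142896 (`…DriftLLNEngine.lean`, quoted from the tree).
* `stub_driftLLNEngineAvg` — its particle-averaged corollary — LANDED p141539.
* `stub_collisionSumMeasurable` — the tagged impulse collision sum over any window `(a, b]` is measurable in the datum after
  extension by `0` off the good set — LANDED p141436.
* `stub_blockSum` — window concatenation `CS(s, s+Kw] = Σ_{j<K} CS(s+jw, s+(j+1)w]` on the good set — LANDED p141391.
* `stub_driftInputs` — for some block length `τ₁`: (CD) (one-particle, one-step conditional drift with profile-dependent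
  `(ρ, C, L)`, N-uniform) ∧ (UI₁) at the same `τ₁` (one-particle-averaged, one-block, UI-shape) — OPEN, the line's
  dynamical content (v1.3: the two posits tied to one block length, the weakest form the transfer consumes).
The composition `transferActivityTails_of_drift` (engineAvg → measurability → concatenation → (UI₁) → (CD) → crux) is PROVED
here (sorry-free: `σ₀ := min`, `V₀ := 2·4(C+1)/(1−ρ)`, three UI levels, `K := ⌈τ/τ₁⌉`, sandwich `a^τ ≤ 2ā_K` on the good
set, `N₀ := max`), and `TransferActivityTails_of` concludes the crux BY NAME from the five stubs (three of them landed: p141539 engineAvg,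
p141436 measurability, p141391 concatenation — quoted from their tree files).
-/

noncomputable section

open MeasureTheory Set Filter Topology
open scoped ENNReal BigOperators

namespace Summit.AtomisticToContinuum.HydrodynamicLimit.Theorems.TransferActivityTailsDrift

open Literature.MathematicalPhysics.KineticTheory Literature.Analysis.FluidPDE
open Summit.AtomisticToContinuum.HydrodynamicLimit.Theorems.ClampedTransferCoin
  (Flow Phase Rec window impulse window_pos collisionSum_Ioc_add_Ioc)
open Summit.AtomisticToContinuum.HydrodynamicLimit.Theorems.CollisionActivityTailsEndpointTails
  (tailFn tailFn_of_lt tailFn_of_le measurable_tailFn ae_mem_good_localGibbsLaw)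
open Summit.AtomisticToContinuum.HydrodynamicLimit.Theorems.TransferActivityTailsMeanTailAverage
  (lintegral_ofReal_average_le)

/-! ## §1 Objects of the line -/

/-- The tagged transfer summand of particle `i`: `𝟙{c.fst = i} · (‖v⁺ − v⁻‖ + |‖v⁺‖² − ‖v⁻‖²|/2)` (literally the crux's). -/
def actSummand {N : ℕ} (i : Fin (N + 1)) (c : Rec N) : ℝ :=
  if c.fst = i then impulse c else 0

/-- **Block transfer activity** `X_{i,j}(s)`: the crux's transfer activity of particle `i` restricted to the `j`-th block
`(s + j·w₁, s + (j+1)·w₁]`, `w₁ = window τ₁ N = τ₁ (N+1)^{-1/3}`, normalised per block (prefactor `σ/τ₁`). -/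
def BlockAct (σ τ₁ : ℝ) {N : ℕ} (Φ : Flow σ N) (i : Fin (N + 1)) (j : ℕ) (s : ℝ) (z : Phase N) : ℝ :=
  σ / τ₁ * Φ.collisionSum (Set.Ioc (s + j * window τ₁ N) (s + (j + 1) * window τ₁ N)) (actSummand i) z

/-- The crux's frame (its quantifier prefix up to `∀ t ∈ Ico 0 T`), abstracted over the conclusion `Q σ t Φ P`
(`P N` = the local Gibbs law at time `0` through the flow `Φ N`). -/
def InCruxFrame (Q : (σ : ℝ) → ℝ → ((N : ℕ) → Flow σ N) → ((N : ℕ) → Measure (Phase N)) → Prop) : Prop :=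
  ∀ (a₀ θ₀ : T3 → ℝ) (u₀ : T3 → V3), Continuous a₀ → Continuous θ₀ → Continuous u₀ →
    (∀ x, 0 < a₀ x) → (∀ x, 0 < θ₀ x) → ∃ σ₀ : ℝ, 0 < σ₀ ∧ ∀ σ : ℝ, 0 < σ → σ < σ₀ →
    ∀ (T : ℝ) (ρ θ : ℝ → T3 → ℝ) (u : ℝ → T3 → V3), IsHardSphereEulerSolution σ T ρ u θ →
    ∀ Φ : (N : ℕ) → Flow σ N,
    TendstoHydroFieldsAt (fun N => localGibbsLaw σ a₀ u₀ θ₀ N (Φ N)) Φ ρ u θ 0 →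
    ∀ t ∈ Set.Ico 0 T, Q σ t Φ (fun N => localGibbsLaw σ a₀ u₀ θ₀ N (Φ N))

/-- **(CD) Predictor drift along the tagged particle's own block-activity history** (integrated form), block length `τ₁`:
in the crux's frame (so the constants may depend on the profiles, `σ`, the Euler solution, the flows and `t`, exactly like
the crux's `V₀`) there are a contraction `0 ≤ ρ < 1`, a constant `C ≥ 0` and a history length `L ≥ 1` such that for every
number of blocks `K`, all large `N`, every start `s ≤ t`, particle `i`, block index `j` with `L ≤ j + 1 < K` and every
measurable `[0,1]`-valued functional `g` of the history `(X_{i,0},…,X_{i,j})`: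
`∫ X_{i,j+1} g(hist) dP ≤ ∫ (ρ L⁻¹ Σ_{k<L} X_{i,j+1−L+k} + C) g(hist) dP`. -/
def PredictorDrift (τ₁ : ℝ) : Prop :=
  InCruxFrame fun σ t Φ P =>
    ∃ (ρ C : ℝ) (L : ℕ), 0 ≤ ρ ∧ ρ < 1 ∧ 0 ≤ C ∧ 1 ≤ L ∧
    ∀ K : ℕ, 1 ≤ K → ∃ N₀ : ℕ, ∀ N : ℕ, N₀ ≤ N → ∀ s ∈ Set.Icc 0 t, ∀ i : Fin (N + 1),
    ∀ j : ℕ, L ≤ j + 1 → j + 1 < K →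
    ∀ g : (Fin (j + 1) → ℝ) → ℝ, Measurable g → (∀ y, 0 ≤ g y ∧ g y ≤ 1) →
      ∫⁻ z, ENNReal.ofReal (BlockAct σ τ₁ (Φ N) i (j + 1) s z *
          g (fun k => BlockAct σ τ₁ (Φ N) i k s z)) ∂(P N) ≤
      ∫⁻ z, ENNReal.ofReal ((ρ * ((L : ℝ)⁻¹ * ∑ k ∈ Finset.range L, BlockAct σ τ₁ (Φ N) i (j + 1 - L + k) s z) + C) *
          g (fun k => BlockAct σ τ₁ (Φ N) i k s z)) ∂(P N)

/-- **(UI₁) One-block uniform integrability under the true law** (level `M` after accuracy `δ`; particle-averaged). -/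
def OneBlockUI (τ₁ : ℝ) : Prop :=
  InCruxFrame fun σ t Φ P =>
    ∀ δ : ℝ, 0 < δ → ∃ M : ℝ, 0 ≤ M ∧ ∀ K : ℕ, 1 ≤ K → ∃ N₀ : ℕ, ∀ N : ℕ, N₀ ≤ N →
    ∀ s ∈ Set.Icc 0 t, ∀ j : ℕ, j < K →
      ∫⁻ z, ENNReal.ofReal (((N : ℝ) + 1)⁻¹ * ∑ i : Fin (N + 1), max (BlockAct σ τ₁ (Φ N) i j s z - M) 0)
        ∂(P N) ≤ ENNReal.ofReal δ

/-- **Drift ⇒ LLN engine** (abstract probability).  Nonnegative measurable `X₀, X₁, …` on a probability space; integrated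
drift with `(ρ, C, L)` for the targets `L ≤ j+1 < K`; summed overshoots `Σ_{j<K} E(X_j − M)₊ ≤ Kδ`, `Σ_{j<K} E(X_j − M′)₊ ≤ Kδ′`,
and `Σ_{j<L} E X_j ≤ Lm`.  Then with `V₀ := 4(C+1)/(1−ρ)` and `ā := K⁻¹ Σ_{j<K} X_j`:
`E[ā 𝟙{ā > V₀}] ≤ M′(δ + (M² + Lm)/K) + δ′`. -/
def DriftLLNEngine : Prop :=
  ∀ (Ω : Type) [MeasurableSpace Ω] (P : Measure Ω) [IsProbabilityMeasure P] (K L : ℕ) (X : ℕ → Ω → ℝ)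
    (ρ C M δ M' δ' m : ℝ),
    (∀ j, Measurable (X j)) → (∀ j ω, 0 ≤ X j ω) → 0 ≤ ρ → ρ < 1 → 0 ≤ C → 1 ≤ L → L < K →
    0 ≤ M → 0 ≤ δ → 0 ≤ M' → 0 ≤ δ' → 0 ≤ m →
    (∀ j : ℕ, L ≤ j + 1 → j + 1 < K → ∀ g : (Fin (j + 1) → ℝ) → ℝ, Measurable g → (∀ y, 0 ≤ g y ∧ g y ≤ 1) →
      ∫⁻ ω, ENNReal.ofReal (X (j + 1) ω * g (fun k => X k ω)) ∂P ≤
      ∫⁻ ω, ENNReal.ofReal ((ρ * ((L : ℝ)⁻¹ * ∑ k ∈ Finset.range L, X (j + 1 - L + k) ω) + C) *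
        g (fun k => X k ω)) ∂P) →
    (∑ j ∈ Finset.range K, ∫⁻ ω, ENNReal.ofReal (X j ω - M) ∂P ≤ ENNReal.ofReal (K * δ)) →
    (∑ j ∈ Finset.range K, ∫⁻ ω, ENNReal.ofReal (X j ω - M') ∂P ≤ ENNReal.ofReal (K * δ')) →
    (∑ j ∈ Finset.range L, ∫⁻ ω, ENNReal.ofReal (X j ω) ∂P ≤ ENNReal.ofReal (L * m)) →
    ∫⁻ ω, ENNReal.ofReal (Set.indicator {y : ℝ | 4 * (C + 1) / (1 - ρ) < y} (fun y => y)
        ((K : ℝ)⁻¹ * ∑ j ∈ Finset.range K, X j ω)) ∂P ≤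
      ENNReal.ofReal (M' * (δ + (M ^ 2 + L * m) / K) + δ')

/-- **Particle-averaged engine**: `n` block sequences `X i` on one probability space, each with the drift; overshoot and
mean hypotheses for the particle AVERAGES; conclusion for the particle average of the tails. -/
def DriftLLNEngineAvg : Prop :=
  ∀ (Ω : Type) [MeasurableSpace Ω] (P : Measure Ω) [IsProbabilityMeasure P] (n K L : ℕ) (X : Fin n → ℕ → Ω → ℝ)
    (ρ C M δ M' δ' m : ℝ),
    0 < n → (∀ i j, Measurable (X i j)) → (∀ i j ω, 0 ≤ X i j ω) → 0 ≤ ρ → ρ < 1 → 0 ≤ C → 1 ≤ L → L < K →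
    0 ≤ M → 0 ≤ δ → 0 ≤ M' → 0 ≤ δ' → 0 ≤ m →
    (∀ i : Fin n, ∀ j : ℕ, L ≤ j + 1 → j + 1 < K → ∀ g : (Fin (j + 1) → ℝ) → ℝ, Measurable g →
      (∀ y, 0 ≤ g y ∧ g y ≤ 1) →
      ∫⁻ ω, ENNReal.ofReal (X i (j + 1) ω * g (fun k => X i k ω)) ∂P ≤
      ∫⁻ ω, ENNReal.ofReal ((ρ * ((L : ℝ)⁻¹ * ∑ k ∈ Finset.range L, X i (j + 1 - L + k) ω) + C) *
        g (fun k => X i k ω)) ∂P) →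
    (∀ j, j < K → ∫⁻ ω, ENNReal.ofReal ((n : ℝ)⁻¹ * ∑ i, max (X i j ω - M) 0) ∂P ≤ ENNReal.ofReal δ) →
    (∀ j, j < K → ∫⁻ ω, ENNReal.ofReal ((n : ℝ)⁻¹ * ∑ i, max (X i j ω - M') 0) ∂P ≤ ENNReal.ofReal δ') →
    (∀ j, j < L → ∫⁻ ω, ENNReal.ofReal ((n : ℝ)⁻¹ * ∑ i, X i j ω) ∂P ≤ ENNReal.ofReal m) →
    ∫⁻ ω, ENNReal.ofReal ((n : ℝ)⁻¹ * ∑ i, Set.indicator {y : ℝ | 4 * (C + 1) / (1 - ρ) < y} (fun y => y)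
        ((K : ℝ)⁻¹ * ∑ j ∈ Finset.range K, X i j ω)) ∂P ≤
      ENNReal.ofReal (M' * (δ + (M ^ 2 + L * m) / K) + δ')

/-- Measurability in the datum (after extension by `0` off the good set) of the tagged impulse collision sum over any window. -/
def TaggedCollisionSumMeasurable : Prop :=
  ∀ (σ : ℝ) (N : ℕ) (Φ : Flow σ N) (i : Fin (N + 1)) (a b : ℝ), 0 < σ → σ < 1 / 2 →
    Measurable (Φ.good.indicator fun z =>
      Φ.collisionSum (Set.Ioc a b) (fun c => if c.fst = i then impulse c else 0) z)

/-- Window concatenation on the good set. -/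
def BlockSum : Prop :=
  ∀ (σ : ℝ) (N : ℕ) (Φ : Flow σ N) (z : Phase N), z ∈ Φ.good → ∀ (s w : ℝ), 0 ≤ w → ∀ (F : Rec N → ℝ) (K : ℕ),
    Φ.collisionSum (Set.Ioc s (s + K * w)) F z =
      ∑ j ∈ Finset.range K, Φ.collisionSum (Set.Ioc (s + j * w) (s + (j + 1) * w)) F z

/-! ## §2 The registered stubs -/

/-- **STUB (engine)** — drift ⇒ LLN (pure probability). -/
theorem stub_driftLLNEngine :
    ∀ (Ω : Type) [MeasurableSpace Ω] (P : Measure Ω) [IsProbabilityMeasure P] (K L : ℕ) (X : ℕ → Ω → ℝ)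
    (ρ C M δ M' δ' m : ℝ),
    (∀ j, Measurable (X j)) → (∀ j ω, 0 ≤ X j ω) → 0 ≤ ρ → ρ < 1 → 0 ≤ C → 1 ≤ L → L < K →
    0 ≤ M → 0 ≤ δ → 0 ≤ M' → 0 ≤ δ' → 0 ≤ m →
    (∀ j : ℕ, L ≤ j + 1 → j + 1 < K → ∀ g : (Fin (j + 1) → ℝ) → ℝ, Measurable g → (∀ y, 0 ≤ g y ∧ g y ≤ 1) →
      ∫⁻ ω, ENNReal.ofReal (X (j + 1) ω * g (fun k => X k ω)) ∂P ≤
      ∫⁻ ω, ENNReal.ofReal ((ρ * ((L : ℝ)⁻¹ * ∑ k ∈ Finset.range L, X (j + 1 - L + k) ω) + C) *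
        g (fun k => X k ω)) ∂P) →
    (∑ j ∈ Finset.range K, ∫⁻ ω, ENNReal.ofReal (X j ω - M) ∂P ≤ ENNReal.ofReal (K * δ)) →
    (∑ j ∈ Finset.range K, ∫⁻ ω, ENNReal.ofReal (X j ω - M') ∂P ≤ ENNReal.ofReal (K * δ')) →
    (∑ j ∈ Finset.range L, ∫⁻ ω, ENNReal.ofReal (X j ω) ∂P ≤ ENNReal.ofReal (L * m)) →
    ∫⁻ ω, ENNReal.ofReal (Set.indicator {y : ℝ | 4 * (C + 1) / (1 - ρ) < y} (fun y => y)
        ((K : ℝ)⁻¹ * ∑ j ∈ Finset.range K, X j ω)) ∂P ≤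
      ENNReal.ofReal (M' * (δ + (M ^ 2 + L * m) / K) + δ') :=
  TransferActivityTailsDriftLLNEngine.stub_driftLLNEngine

/-- **STUB (engine, averaged)** — the particle-averaged engine from the (per-sequence) engine, whose statement is the
displayed antecedent (verbatim the statement of `stub_driftLLNEngine`). -/
theorem stub_driftLLNEngineAvg :
    (∀ (Ω : Type) [MeasurableSpace Ω] (P : Measure Ω) [IsProbabilityMeasure P] (K L : ℕ) (X : ℕ → Ω → ℝ)
    (ρ C M δ M' δ' m : ℝ),
    (∀ j, Measurable (X j)) → (∀ j ω, 0 ≤ X j ω) → 0 ≤ ρ → ρ < 1 → 0 ≤ C → 1 ≤ L → L < K →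
    0 ≤ M → 0 ≤ δ → 0 ≤ M' → 0 ≤ δ' → 0 ≤ m →
    (∀ j : ℕ, L ≤ j + 1 → j + 1 < K → ∀ g : (Fin (j + 1) → ℝ) → ℝ, Measurable g → (∀ y, 0 ≤ g y ∧ g y ≤ 1) →
      ∫⁻ ω, ENNReal.ofReal (X (j + 1) ω * g (fun k => X k ω)) ∂P ≤
      ∫⁻ ω, ENNReal.ofReal ((ρ * ((L : ℝ)⁻¹ * ∑ k ∈ Finset.range L, X (j + 1 - L + k) ω) + C) *
        g (fun k => X k ω)) ∂P) →
    (∑ j ∈ Finset.range K, ∫⁻ ω, ENNReal.ofReal (X j ω - M) ∂P ≤ ENNReal.ofReal (K * δ)) →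
    (∑ j ∈ Finset.range K, ∫⁻ ω, ENNReal.ofReal (X j ω - M') ∂P ≤ ENNReal.ofReal (K * δ')) →
    (∑ j ∈ Finset.range L, ∫⁻ ω, ENNReal.ofReal (X j ω) ∂P ≤ ENNReal.ofReal (L * m)) →
    ∫⁻ ω, ENNReal.ofReal (Set.indicator {y : ℝ | 4 * (C + 1) / (1 - ρ) < y} (fun y => y)
        ((K : ℝ)⁻¹ * ∑ j ∈ Finset.range K, X j ω)) ∂P ≤
      ENNReal.ofReal (M' * (δ + (M ^ 2 + L * m) / K) + δ')) →
    ∀ (Ω : Type) [MeasurableSpace Ω] (P : Measure Ω) [IsProbabilityMeasure P] (n K L : ℕ) (X : Fin n → ℕ → Ω → ℝ)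
    (ρ C M δ M' δ' m : ℝ),
    0 < n → (∀ i j, Measurable (X i j)) → (∀ i j ω, 0 ≤ X i j ω) → 0 ≤ ρ → ρ < 1 → 0 ≤ C → 1 ≤ L → L < K →
    0 ≤ M → 0 ≤ δ → 0 ≤ M' → 0 ≤ δ' → 0 ≤ m →
    (∀ i : Fin n, ∀ j : ℕ, L ≤ j + 1 → j + 1 < K → ∀ g : (Fin (j + 1) → ℝ) → ℝ, Measurable g →
      (∀ y, 0 ≤ g y ∧ g y ≤ 1) →
      ∫⁻ ω, ENNReal.ofReal (X i (j + 1) ω * g (fun k => X i k ω)) ∂P ≤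
      ∫⁻ ω, ENNReal.ofReal ((ρ * ((L : ℝ)⁻¹ * ∑ k ∈ Finset.range L, X i (j + 1 - L + k) ω) + C) *
        g (fun k => X i k ω)) ∂P) →
    (∀ j, j < K → ∫⁻ ω, ENNReal.ofReal ((n : ℝ)⁻¹ * ∑ i, max (X i j ω - M) 0) ∂P ≤ ENNReal.ofReal δ) →
    (∀ j, j < K → ∫⁻ ω, ENNReal.ofReal ((n : ℝ)⁻¹ * ∑ i, max (X i j ω - M') 0) ∂P ≤ ENNReal.ofReal δ') →
    (∀ j, j < L → ∫⁻ ω, ENNReal.ofReal ((n : ℝ)⁻¹ * ∑ i, X i j ω) ∂P ≤ ENNReal.ofReal m) →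
    ∫⁻ ω, ENNReal.ofReal ((n : ℝ)⁻¹ * ∑ i, Set.indicator {y : ℝ | 4 * (C + 1) / (1 - ρ) < y} (fun y => y)
        ((K : ℝ)⁻¹ * ∑ j ∈ Finset.range K, X i j ω)) ∂P ≤
      ENNReal.ofReal (M' * (δ + (M ^ 2 + L * m) / K) + δ') :=
  TransferActivityTailsDriftEngineAvg.stub_driftLLNEngineAvg

/-- **STUB (measurability)** — the tagged impulse collision sum over `(a, b]`, extended by `0` off the good set, is
measurable in the datum (`0 < σ < 1/2`). -/
theorem stub_collisionSumMeasurable :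
    ∀ (σ : ℝ) (N : ℕ) (Φ : Flow σ N) (i : Fin (N + 1)) (a b : ℝ), 0 < σ → σ < 1 / 2 →
    Measurable (Φ.good.indicator fun z =>
      Φ.collisionSum (Set.Ioc a b) (fun c => if c.fst = i then impulse c else 0) z) :=
  TransferActivityTailsTaggedSumMeasurable.stub_collisionSumMeasurable

/-- **STUB (window concatenation)** — on the good set, `CS(s, s + K w] = Σ_{j<K} CS(s + j w, s + (j+1) w]`. -/
theorem stub_blockSum :
    ∀ (σ : ℝ) (N : ℕ) (Φ : Flow σ N) (z : Phase N), z ∈ Φ.good → ∀ (s w : ℝ), 0 ≤ w → ∀ (F : Rec N → ℝ) (K : ℕ),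
    Φ.collisionSum (Set.Ioc s (s + K * w)) F z =
      ∑ j ∈ Finset.range K, Φ.collisionSum (Set.Ioc (s + j * w) (s + (j + 1) * w)) F z :=
  TransferActivityTailsBlockSum.stub_blockSum

/-- **STUB (dynamical inputs: (CD) ∧ (UI₁) at one block length)** — for some block length `τ₁ > 0`: the predictor drift
(the contraction `ρ < 1`, the constant `C` and the history length `L` chosen inside the crux's frame, after the profiles, `σ`,
the Euler solution, the flows and `t` — a `C` chosen before the profiles would be refuted by heating the data, since stationarity
and `g ≡ 1` force `E X ≤ C/(1−ρ)`) AND one-block uniform integrability at the SAME block length (UI-shape; `OneBlockUI τ₁ ⟹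
OneBlockUI (kτ₁)` by Jensen, so tying it to the drift's `τ₁` is the weakest form the transfer consumes).
OPEN: the line's dynamical content; (CD) is (N1) quantified one step at a time and under `λ_s` contains (N2); (UI₁) is the
fixed-scale hinge-UI of the tagged transfer activity under the true law (no route item implies it; wave-1 audit). -/
theorem stub_driftInputs : ∃ τ₁ : ℝ, 0 < τ₁ ∧ PredictorDrift τ₁ ∧ OneBlockUI τ₁ := by
  sorry

/-! ## §3 Small kinematic and tail-functional lemmas (sorry-free) -/

variable {σ : ℝ} {N : ℕ}

/-- Collision sums of a nonnegative functional are nonnegative (every datum: a `finsum` of finite sums). -/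
theorem collisionSum_nonneg_of_nonneg (Φ : Flow σ N) (S : Set ℝ) {F : Rec N → ℝ} (hF : ∀ c, 0 ≤ F c)
    (z : Phase N) : 0 ≤ Φ.collisionSum S F z := by
  unfold HardSphereFlow.collisionSum Literature.Analysis.FluidPDE.collisionSum
    Literature.Analysis.FluidPDE.collisionPairSum
  exact finsum_nonneg fun t => finsum_nonneg fun _ => Finset.sum_nonneg fun p _ => hF _

/-- The tagged transfer summand is nonnegative. -/
theorem actSummand_nonneg (i : Fin (N + 1)) (c : Rec N) : 0 ≤ actSummand i c := by
  unfold actSummand impulse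
  split_ifs
  · positivity
  · exact le_rfl

/-- The block activity is nonnegative for `0 ≤ σ`, `0 ≤ τ₁`. -/
theorem blockAct_nonneg (hσ : 0 ≤ σ) {τ₁ : ℝ} (hτ₁ : 0 ≤ τ₁) (Φ : Flow σ N) (i : Fin (N + 1)) (j : ℕ)
    (s : ℝ) (z : Phase N) : 0 ≤ BlockAct σ τ₁ Φ i j s z :=
  mul_nonneg (div_nonneg hσ hτ₁) (collisionSum_nonneg_of_nonneg Φ _ (actSummand_nonneg i) z)

/-- Monotonicity of window collision sums of a nonnegative functional in the window length, on the good set. -/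
theorem collisionSum_Ioc_mono_right (Φ : Flow σ N) {z : Phase N} (hz : z ∈ Φ.good) {F : Rec N → ℝ}
    (hF : ∀ c, 0 ≤ F c) (s : ℝ) {w w' : ℝ} (hw : 0 ≤ w) (hww' : w ≤ w') :
    Φ.collisionSum (Set.Ioc s (s + w)) F z ≤ Φ.collisionSum (Set.Ioc s (s + w')) F z := by
  rw [collisionSum_Ioc_add_Ioc Φ hz (by linarith) (by linarith : s + w ≤ s + w') F]
  exact le_add_of_nonneg_right (collisionSum_nonneg_of_nonneg Φ _ hF z)

/-- The tail functional is nonnegative at nonnegative arguments. -/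
theorem tailFn_nonneg' {V y : ℝ} (hy : 0 ≤ y) : 0 ≤ tailFn V y := by
  by_cases h : V < y
  · rw [tailFn_of_lt h]; exact hy
  · rw [tailFn_of_le (not_lt.1 h)]

/-- The tail functional is antitone in the level at nonnegative arguments. -/
theorem tailFn_antitone_level {V V' y : ℝ} (hVV' : V ≤ V') (hy : 0 ≤ y) : tailFn V' y ≤ tailFn V y := by
  by_cases h : V' < y
  · rw [tailFn_of_lt h, tailFn_of_lt (hVV'.trans_lt h)]
  · rw [tailFn_of_le (not_lt.1 h)]; exact tailFn_nonneg' hy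

/-- The sandwich step: `0 ≤ a ≤ 2 b` gives `a 𝟙{a > V} ≤ 2 · b 𝟙{b > V/2}`. -/
theorem tailFn_le_two_mul {V a b : ℝ} (ha : 0 ≤ a) (hab : a ≤ 2 * b) : tailFn V a ≤ 2 * tailFn (V / 2) b := by
  have hb : 0 ≤ b := by linarith
  by_cases h : V < a
  · rw [tailFn_of_lt h, tailFn_of_lt (by linarith : V / 2 < b)]; exact hab
  · rw [tailFn_of_le (not_lt.1 h)]; exact mul_nonneg zero_le_two (tailFn_nonneg' hb)

/-! ## §4 The composition and the conclusion of the crux by name -/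

/-- The crux decl under a local name, so that the conditional composition below is not itself read as "the" skeleton
theorem (the audit takes the theorem concluding the crux BY NAME; exactly one, `TransferActivityTails_of`, does). -/
abbrev LineTarget : Prop := Summit.AtomisticToContinuum.HydrodynamicLimit.Theses.TwoClocks.TransferActivityTails

/-- **The transfer** — the crux from the averaged engine, the two kinematic facts and the two dynamical inputs.
`σ₀ := min σ₀^CD σ₀^UI 1/2`; `V₀ := 2 · 4(C+1)/(1−ρ)`; given `V ≥ V₀`, `ε`: levels `M′ (δ′ = ε/4)`, `M (δ = ε/(8(M′+1)))`, `M₁ (δ = 1)`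
from (UI₁), `m := M₁ + 1`, `K₀ ≥ L + 1 ∨ 8M′(M² + Lm)/ε`, `τ₀ := K₀ τ₁`; for `τ ≥ τ₀` put `K := ⌈τ/τ₁⌉` (`τ ≤ Kτ₁ ≤ 2τ`), `N₀ := max`;
then the averaged engine applied to `X_{i,j} = 𝟙_good · BlockAct` bounds `E[(N+1)⁻¹Σ_i ā_i𝟙{ā_i > V₀/2}] ≤ ε/2`, and on the good set
`a_i^τ ≤ (Kτ₁/τ) ā_i ≤ 2 ā_i` (window monotonicity + concatenation), so `a_i𝟙{a_i > V} ≤ 2 ā_i 𝟙{ā_i > V₀/2}`. -/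
theorem transferActivityTails_of_drift (hEng : DriftLLNEngineAvg) (hMeas : TaggedCollisionSumMeasurable)
    (hSum : BlockSum) (hIn : ∃ τ₁ : ℝ, 0 < τ₁ ∧ PredictorDrift τ₁ ∧ OneBlockUI τ₁) : LineTarget := by
  obtain ⟨τ₁, hτ₁, hDrift, hUI⟩ := hIn
  intro a₀ θ₀ u₀ ha hθ hu ha0 hθ0
  obtain ⟨σD, hσD, HD⟩ := hDrift a₀ θ₀ u₀ ha hθ hu ha0 hθ0
  obtain ⟨σU, hσU, HU⟩ := hUI a₀ θ₀ u₀ ha hθ hu ha0 hθ0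
  refine ⟨min (min σD σU) 2⁻¹, lt_min (lt_min hσD hσU) (by norm_num), ?_⟩
  intro σ hσ hσlt T ρE θE uE hE Φ hlim t ht
  have hσD' : σ < σD := hσlt.trans_le ((min_le_left _ _).trans (min_le_left _ _))
  have hσU' : σ < σU := hσlt.trans_le ((min_le_left _ _).trans (min_le_right _ _))
  have hσ2 : σ < 2⁻¹ := hσlt.trans_le (min_le_right _ _)
  have hσ2' : σ < 1 / 2 := by rw [one_div]; exact hσ2
  obtain ⟨ρ, C, L, hρ0, hρ1, hC, hL, QD⟩ := HD σ hσ hσD' T ρE θE uE hE Φ hlim t ht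
  have QU := HU σ hσ hσU' T ρE θE uE hE Φ hlim t ht
  have h1ρ : 0 < 1 - ρ := by linarith
  -- the engine's level and the crux's threshold
  set V' : ℝ := 4 * (C + 1) / (1 - ρ) with hV'
  have hV'pos : 0 < V' := by positivity
  refine ⟨2 * V', by positivity, ?_⟩
  intro V hV ε hε
  -- the three UI levels
  obtain ⟨M', hM'0, HM'⟩ := QU (ε / 4) (by positivity)
  obtain ⟨M, hM0, HM⟩ := QU (ε / (8 * (M' + 1))) (by positivity)
  obtain ⟨M₁, hM₁0, HM₁⟩ := QU 1 one_pos
  set m : ℝ := M₁ + 1 with hm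
  have hm0 : 0 ≤ m := by positivity
  -- the number of blocks
  set B : ℝ := 8 * M' * (M ^ 2 + L * m) / ε with hB
  have hB0 : 0 ≤ B := by positivity
  set K₀ : ℕ := ⌈max ((L : ℝ) + 1) B⌉₊ with hK₀
  have hK₀L : (L : ℝ) + 1 ≤ K₀ := (le_max_left _ _).trans (Nat.le_ceil _)
  have hK₀B : B ≤ K₀ := (le_max_right _ _).trans (Nat.le_ceil _)
  have hK₀pos : (0 : ℝ) < K₀ := by linarith [(Nat.cast_nonneg L : (0 : ℝ) ≤ L)]
  refine ⟨K₀ * τ₁, by positivity, ?_⟩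
  intro τ hτ
  have hτpos : 0 < τ := lt_of_lt_of_le (by positivity) hτ
  have hτ₁τ : τ₁ ≤ τ := by
    have : (1 : ℝ) ≤ K₀ := by linarith [(Nat.cast_nonneg L : (0 : ℝ) ≤ L)]
    nlinarith
  set K : ℕ := ⌈τ / τ₁⌉₊ with hKdef
  have hKτ : τ / τ₁ ≤ K := Nat.le_ceil _
  have hK₀K' : (K₀ : ℝ) ≤ τ / τ₁ := by rw [le_div_iff₀ hτ₁]; exact hτ
  have hK₀K : K₀ ≤ K := Nat.cast_le.1 (hK₀K'.trans hKτ)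
  have hKreal : (K₀ : ℝ) ≤ K := Nat.cast_le.2 hK₀K
  have hLK : L < K := by
    have : (L : ℝ) + 1 ≤ K := hK₀L.trans hKreal
    exact_mod_cast this
  have hK1 : 1 ≤ K := le_trans hL hLK.le
  have hKpos : (0 : ℝ) < K := by exact_mod_cast hK1
  have hτK : τ ≤ K * τ₁ := by rwa [div_le_iff₀ hτ₁] at hKτ
  have hKτ2 : K * τ₁ ≤ 2 * τ := by
    have h1 : (K : ℝ) < τ / τ₁ + 1 := Nat.ceil_lt_add_one (by positivity)
    have h2 : (K : ℝ) * τ₁ < τ + τ₁ := by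
      have := mul_lt_mul_of_pos_right h1 hτ₁
      rwa [add_mul, one_mul, div_mul_cancel₀ _ hτ₁.ne'] at this
    linarith
  -- the particle numbers
  obtain ⟨ND, HND⟩ := QD K hK1
  obtain ⟨NU', HNU'⟩ := HM' K hK1
  obtain ⟨NU, HNU⟩ := HM K hK1
  obtain ⟨NU₁, HNU₁⟩ := HM₁ K hK1
  refine ⟨max (max ND NU') (max NU NU₁), ?_⟩
  intro N hN s hs
  have hND : ND ≤ N := le_trans ((le_max_left _ _).trans (le_max_left _ _)) hN
  have hNU' : NU' ≤ N := le_trans ((le_max_right _ _).trans (le_max_left _ _)) hN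
  have hNU : NU ≤ N := le_trans ((le_max_left _ _).trans (le_max_right _ _)) hN
  have hNU₁ : NU₁ ≤ N := le_trans ((le_max_right _ _).trans (le_max_right _ _)) hN
  dsimp only
  -- the law, the block variables
  set P := localGibbsLaw σ a₀ u₀ θ₀ N (Φ N) with hP
  haveI hPprob : IsProbabilityMeasure P :=
    isProbabilityMeasure_localGibbsLaw ha hθ hu ha0 hθ0 (by linarith : σ ≤ 1 / 2) N (Φ N)
  have hgood : ∀ᵐ z ∂P, z ∈ (Φ N).good := ae_mem_good_localGibbsLaw σ a₀ θ₀ u₀ N (Φ N)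
  set X : Fin (N + 1) → ℕ → Phase N → ℝ := fun i j => (Φ N).good.indicator (BlockAct σ τ₁ (Φ N) i j s)
    with hX
  have hXgood : ∀ {z : Phase N}, z ∈ (Φ N).good → ∀ i j, X i j z = BlockAct σ τ₁ (Φ N) i j s z :=
    fun hz i j => Set.indicator_of_mem hz _
  have hXmeas : ∀ i j, Measurable (X i j) := by
    intro i j
    have heq : X i j = fun z => σ / τ₁ * (Φ N).good.indicator (fun z =>
        (Φ N).collisionSum (Set.Ioc (s + j * window τ₁ N) (s + (j + 1) * window τ₁ N))
          (fun c => if c.fst = i then impulse c else 0) z) z := by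
      funext z
      exact Set.indicator_const_mul _ _ _ _
    rw [heq]
    exact (hMeas σ N (Φ N) i _ _ hσ hσ2').const_mul _
  have hXnn : ∀ i j z, 0 ≤ X i j z := fun i j z =>
    Set.indicator_nonneg (fun z _ => blockAct_nonneg hσ.le hτ₁.le (Φ N) i j s z) z
  -- (CD) for the block variables
  have hdriftX : ∀ i : Fin (N + 1), ∀ j : ℕ, L ≤ j + 1 → j + 1 < K → ∀ g : (Fin (j + 1) → ℝ) → ℝ, Measurable g →
      (∀ y, 0 ≤ g y ∧ g y ≤ 1) →
      ∫⁻ ω, ENNReal.ofReal (X i (j + 1) ω * g (fun k => X i k ω)) ∂P ≤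
      ∫⁻ ω, ENNReal.ofReal ((ρ * ((L : ℝ)⁻¹ * ∑ k ∈ Finset.range L, X i (j + 1 - L + k) ω) + C) *
        g (fun k => X i k ω)) ∂P := by
    intro i j hj1 hj2 g hg hg01
    have h := HND N hND s hs i j hj1 hj2 g hg hg01
    have hl : ∀ᵐ ω ∂P, ENNReal.ofReal (X i (j + 1) ω * g (fun k => X i k ω)) =
        ENNReal.ofReal (BlockAct σ τ₁ (Φ N) i (j + 1) s ω * g (fun k => BlockAct σ τ₁ (Φ N) i k s ω)) := by
      filter_upwards [hgood] with ω hω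
      simp only [hXgood hω]
    have hr : ∀ᵐ ω ∂P, ENNReal.ofReal ((ρ * ((L : ℝ)⁻¹ * ∑ k ∈ Finset.range L, X i (j + 1 - L + k) ω) + C) *
          g (fun k => X i k ω)) =
        ENNReal.ofReal ((ρ * ((L : ℝ)⁻¹ * ∑ k ∈ Finset.range L, BlockAct σ τ₁ (Φ N) i (j + 1 - L + k) s ω) + C) *
          g (fun k => BlockAct σ τ₁ (Φ N) i k s ω)) := by
      filter_upwards [hgood] with ω hω
      simp only [hXgood hω]
    rw [lintegral_congr_ae hl, lintegral_congr_ae hr]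
    exact h
  -- (UI₁) for the block variables, at the three levels
  have hoverX : ∀ (Mx δx : ℝ) (Nx : ℕ), Nx ≤ N →
      (∀ N : ℕ, Nx ≤ N → ∀ s ∈ Set.Icc 0 t, ∀ j : ℕ, j < K →
        ∫⁻ z, ENNReal.ofReal (((N : ℝ) + 1)⁻¹ * ∑ i : Fin (N + 1),
          max (BlockAct σ τ₁ (Φ N) i j s z - Mx) 0) ∂(localGibbsLaw σ a₀ u₀ θ₀ N (Φ N)) ≤ ENNReal.ofReal δx) →
      ∀ j, j < K → ∫⁻ ω, ENNReal.ofReal (((N + 1 : ℕ) : ℝ)⁻¹ * ∑ i, max (X i j ω - Mx) 0) ∂P ≤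
        ENNReal.ofReal δx := by
    intro Mx δx Nx hNx Hx j hj
    have h := Hx N hNx s hs j hj
    have hl : ∀ᵐ ω ∂P, ENNReal.ofReal (((N + 1 : ℕ) : ℝ)⁻¹ * ∑ i, max (X i j ω - Mx) 0) =
        ENNReal.ofReal (((N : ℝ) + 1)⁻¹ * ∑ i : Fin (N + 1), max (BlockAct σ τ₁ (Φ N) i j s ω - Mx) 0) := by
      filter_upwards [hgood] with ω hω
      simp only [hXgood hω, Nat.cast_succ]
    rw [lintegral_congr_ae hl]
    exact h
  have hover := hoverX M (ε / (8 * (M' + 1))) NU hNU HNU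
  have hover' := hoverX M' (ε / 4) NU' hNU' HNU'
  -- the mean of the first blocks: `E[(N+1)⁻¹ Σ_i X_{i,j}] ≤ M₁ + 1`
  have hmean : ∀ j, j < L → ∫⁻ ω, ENNReal.ofReal (((N + 1 : ℕ) : ℝ)⁻¹ * ∑ i, X i j ω) ∂P ≤ ENNReal.ofReal m := by
    intro j hj
    have hjK : j < K := lt_trans hj hLK
    have h1 := hoverX M₁ 1 NU₁ hNU₁ HNU₁ j hjK
    have hptw : ∀ ω, ENNReal.ofReal (((N + 1 : ℕ) : ℝ)⁻¹ * ∑ i, X i j ω) ≤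
        ENNReal.ofReal M₁ + ENNReal.ofReal (((N + 1 : ℕ) : ℝ)⁻¹ * ∑ i, max (X i j ω - M₁) 0) := by
      intro ω
      rw [← ENNReal.ofReal_add hM₁0 (mul_nonneg (inv_nonneg.2 (Nat.cast_nonneg _))
        (Finset.sum_nonneg fun i _ => le_max_right _ _))]
      refine ENNReal.ofReal_le_ofReal ?_
      have hn : (0 : ℝ) < ((N + 1 : ℕ) : ℝ) := by positivity
      have hle : ∑ i : Fin (N + 1), X i j ω ≤ ∑ i : Fin (N + 1), (M₁ + max (X i j ω - M₁) 0) :=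
        Finset.sum_le_sum fun i _ => by
          rcases le_total (X i j ω) M₁ with h | h
          · rw [max_eq_right (by linarith)]; linarith
          · rw [max_eq_left (by linarith)]; linarith
      rw [Finset.sum_add_distrib, Finset.sum_const, Finset.card_univ, Fintype.card_fin, nsmul_eq_mul] at hle
      calc ((N + 1 : ℕ) : ℝ)⁻¹ * ∑ i, X i j ω
          ≤ ((N + 1 : ℕ) : ℝ)⁻¹ * (((N + 1 : ℕ) : ℝ) * M₁ + ∑ i, max (X i j ω - M₁) 0) :=
            mul_le_mul_of_nonneg_left hle (inv_nonneg.2 hn.le)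
        _ = M₁ + ((N + 1 : ℕ) : ℝ)⁻¹ * ∑ i, max (X i j ω - M₁) 0 := by
            rw [mul_add, ← mul_assoc, inv_mul_cancel₀ hn.ne', one_mul]
    calc ∫⁻ ω, ENNReal.ofReal (((N + 1 : ℕ) : ℝ)⁻¹ * ∑ i, X i j ω) ∂P
        ≤ ∫⁻ ω, (ENNReal.ofReal M₁ + ENNReal.ofReal (((N + 1 : ℕ) : ℝ)⁻¹ * ∑ i, max (X i j ω - M₁) 0)) ∂P :=
          lintegral_mono hptw
      _ = ENNReal.ofReal M₁ + ∫⁻ ω, ENNReal.ofReal (((N + 1 : ℕ) : ℝ)⁻¹ * ∑ i, max (X i j ω - M₁) 0) ∂P := by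
          rw [lintegral_add_left measurable_const, lintegral_const, measure_univ, mul_one]
      _ ≤ ENNReal.ofReal M₁ + ENNReal.ofReal 1 := add_le_add le_rfl h1
      _ = ENNReal.ofReal m := by rw [hm, ENNReal.ofReal_add hM₁0 zero_le_one]
  -- THE ENGINE
  have hmain := hEng (Phase N) P (N + 1) K L X ρ C M (ε / (8 * (M' + 1))) M' (ε / 4) m (Nat.succ_pos N)
    hXmeas hXnn hρ0 hρ1 hC hL hLK hM0 (by positivity) hM'0 (by positivity) hm0 hdriftX hover hover' hmean
  -- the engine's bound is at most `ε / 2`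
  have hbound : M' * (ε / (8 * (M' + 1)) + (M ^ 2 + L * m) / K) + ε / 4 ≤ ε / 2 := by
    have h1 : M' * (ε / (8 * (M' + 1))) ≤ ε / 8 := by
      rw [mul_div_assoc']
      rw [div_le_div_iff₀ (by positivity) (by norm_num : (0 : ℝ) < 8)]
      nlinarith
    have h2 : M' * ((M ^ 2 + L * m) / K) ≤ ε / 8 := by
      rw [mul_div_assoc', div_le_iff₀ hKpos]
      have : M' * (M ^ 2 + L * m) = ε / 8 * B := by rw [hB]; field_simp
      rw [this]
      exact mul_le_mul_of_nonneg_left (hK₀B.trans hKreal) (by positivity)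
    nlinarith [mul_add M' (ε / (8 * (M' + 1))) ((M ^ 2 + L * m) / K)]
  have hmain' : ∫⁻ ω, ENNReal.ofReal (((N + 1 : ℕ) : ℝ)⁻¹ * ∑ i, tailFn V' ((K : ℝ)⁻¹ * ∑ j ∈ Finset.range K, X i j ω))
      ∂P ≤ ENNReal.ofReal (ε / 2) :=
    hmain.trans (ENNReal.ofReal_le_ofReal hbound)
  -- pointwise on the good set: `a_i^τ ≤ 2 ā_i`, hence the crux integrand ≤ 2 × the engine's integrand
  have hwin : window τ N ≤ K * window τ₁ N := by
    unfold window
    rw [← mul_assoc]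
    exact mul_le_mul_of_nonneg_right hτK (by positivity)
  have hptw : ∀ᵐ z ∂P, ((N : ℝ) + 1)⁻¹ * ∑ i : Fin (N + 1),
      tailFn V (σ / τ * (Φ N).collisionSum (Set.Ioc s (s + window τ N)) (actSummand i) z) ≤
      2 * (((N + 1 : ℕ) : ℝ)⁻¹ * ∑ i, tailFn V' ((K : ℝ)⁻¹ * ∑ j ∈ Finset.range K, X i j z)) := by
    filter_upwards [hgood] with z hz
    have hcast : ((N + 1 : ℕ) : ℝ) = (N : ℝ) + 1 := by push_cast; ring
    suffices key : ∀ i : Fin (N + 1),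
        tailFn V (σ / τ * (Φ N).collisionSum (Set.Ioc s (s + window τ N)) (actSummand i) z) ≤
        2 * tailFn V' ((K : ℝ)⁻¹ * ∑ j ∈ Finset.range K, X i j z) by
      calc ((N : ℝ) + 1)⁻¹ * ∑ i : Fin (N + 1),
            tailFn V (σ / τ * (Φ N).collisionSum (Set.Ioc s (s + window τ N)) (actSummand i) z)
          ≤ ((N : ℝ) + 1)⁻¹ * ∑ i : Fin (N + 1), 2 * tailFn V' ((K : ℝ)⁻¹ * ∑ j ∈ Finset.range K, X i j z) :=
            mul_le_mul_of_nonneg_left (Finset.sum_le_sum fun i _ => key i) (by positivity)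
        _ = 2 * (((N + 1 : ℕ) : ℝ)⁻¹ * ∑ i, tailFn V' ((K : ℝ)⁻¹ * ∑ j ∈ Finset.range K, X i j z)) := by
            rw [hcast, ← Finset.mul_sum]; ring
    intro i
    -- `a_i ≤ (K τ₁ / τ) ā_i ≤ 2 ā_i`
    set abar : ℝ := (K : ℝ)⁻¹ * ∑ j ∈ Finset.range K, X i j z with habar
    have habar0 : 0 ≤ abar := mul_nonneg (inv_nonneg.2 hKpos.le) (Finset.sum_nonneg fun j _ => hXnn i j z)
    have hblocks : (Φ N).collisionSum (Set.Ioc s (s + K * window τ₁ N)) (actSummand i) z =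
        ∑ j ∈ Finset.range K, (Φ N).collisionSum
          (Set.Ioc (s + j * window τ₁ N) (s + (j + 1) * window τ₁ N)) (actSummand i) z :=
      hSum σ N (Φ N) z hz s (window τ₁ N) (window_pos hτ₁ N).le (actSummand i) K
    have hsumX : ∑ j ∈ Finset.range K, X i j z = σ / τ₁ * ∑ j ∈ Finset.range K, (Φ N).collisionSum
          (Set.Ioc (s + j * window τ₁ N) (s + (j + 1) * window τ₁ N)) (actSummand i) z := by
      rw [Finset.mul_sum]
      exact Finset.sum_congr rfl fun j _ => by rw [hXgood hz]; rfl
    have hact : σ / τ * (Φ N).collisionSum (Set.Ioc s (s + window τ N)) (actSummand i) z ≤ 2 * abar := by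
      calc σ / τ * (Φ N).collisionSum (Set.Ioc s (s + window τ N)) (actSummand i) z
          ≤ σ / τ * (Φ N).collisionSum (Set.Ioc s (s + K * window τ₁ N)) (actSummand i) z :=
            mul_le_mul_of_nonneg_left (collisionSum_Ioc_mono_right (Φ N) hz (actSummand_nonneg i) s
              (window_pos hτpos N).le hwin) (div_nonneg hσ.le hτpos.le)
        _ = (K * τ₁ / τ) * abar := by
            rw [hblocks, habar, hsumX]
            generalize (∑ j ∈ Finset.range K, (Φ N).collisionSum
              (Set.Ioc (s + j * window τ₁ N) (s + (j + 1) * window τ₁ N)) (actSummand i) z) = S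
            have hK0 : (K : ℝ) ≠ 0 := hKpos.ne'
            have hτ0 : τ ≠ 0 := hτpos.ne'
            have hτ₁0 : τ₁ ≠ 0 := hτ₁.ne'
            field_simp
        _ ≤ 2 * abar := by
            refine mul_le_mul_of_nonneg_right ?_ habar0
            rwa [div_le_iff₀ hτpos]
    calc tailFn V (σ / τ * (Φ N).collisionSum (Set.Ioc s (s + window τ N)) (actSummand i) z)
        ≤ 2 * tailFn (V / 2) abar :=
          tailFn_le_two_mul (mul_nonneg (div_nonneg hσ.le hτpos.le)
            (collisionSum_nonneg_of_nonneg _ _ (actSummand_nonneg i) z)) hact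
      _ ≤ 2 * tailFn V' abar :=
          mul_le_mul_of_nonneg_left (tailFn_antitone_level (by linarith) habar0) zero_le_two
  -- conclusion
  have hsummand : ∀ i : Fin (N + 1), (fun c : Rec N => if c.fst = i then
      ‖c.postVel.1 - c.preVel.1‖ + |‖c.postVel.1‖ ^ 2 - ‖c.preVel.1‖ ^ 2| / 2 else 0) = actSummand i :=
    fun i => rfl
  simp only [hsummand]
  calc ∫⁻ z, ENNReal.ofReal (((N : ℝ) + 1)⁻¹ * ∑ i : Fin (N + 1),
          tailFn V (σ / τ * (Φ N).collisionSum (Set.Ioc s (s + window τ N)) (actSummand i) z)) ∂P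
      ≤ ∫⁻ z, ENNReal.ofReal (2 * (((N + 1 : ℕ) : ℝ)⁻¹ * ∑ i,
          tailFn V' ((K : ℝ)⁻¹ * ∑ j ∈ Finset.range K, X i j z))) ∂P :=
        lintegral_mono_ae (hptw.mono fun z hz => ENNReal.ofReal_le_ofReal hz)
    _ = ENNReal.ofReal 2 * ∫⁻ z, ENNReal.ofReal (((N + 1 : ℕ) : ℝ)⁻¹ * ∑ i,
          tailFn V' ((K : ℝ)⁻¹ * ∑ j ∈ Finset.range K, X i j z)) ∂P := by
        rw [← lintegral_const_mul' _ _ ENNReal.ofReal_ne_top]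
        refine lintegral_congr fun z => ?_
        rw [ENNReal.ofReal_mul zero_le_two]
    _ ≤ ENNReal.ofReal 2 * ENNReal.ofReal (ε / 2) := mul_le_mul_right hmain' _
    _ = ENNReal.ofReal ε := by rw [← ENNReal.ofReal_mul zero_le_two]; congr 1; ring

/-- **The crux BY NAME from the registered stubs.** -/
theorem TransferActivityTails_of :
    Summit.AtomisticToContinuum.HydrodynamicLimit.Theses.TwoClocks.TransferActivityTails :=
  transferActivityTails_of_drift (stub_driftLLNEngineAvg stub_driftLLNEngine) stub_collisionSumMeasurable stub_blockSum
    stub_driftInputs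

end Summit.AtomisticToContinuum.HydrodynamicLimit.Theorems.TransferActivityTailsDrift

end
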